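import Summits.Ventures.QEC.Census.CertChunks
import Summits.Ventures.QEC.Census.BB.BB72.Cert
import HarnessLib

/-!
# `BB72` — KERNEL-tier lower-bound replay, side X, leaf file 8/10 (emitted by qec-search-7)

Bruteforce replay (CERT-FORMAT v1 §5.1, lemma L3) of the certificate `7e943c5a566adc43`: every X-type operator of weight
`1 … 5` has nonzero syndrome (rows `cert.HZ`) or is allow-listed (allow-list []). This file holds
10 packed chunk evaluations (`chunk1R`/`chunk2R` of `Census/CertChunks.lean` over `posList 72 cert.HZ`), total
1536307 scan end points, each closed by `decide +kernel` — tier KERNEL (CERTIFIED): axioms ⊆ {propext, Classical.choice,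
Quot.sound}. Assembled in `BB/BB72/KernelX.lean`. Do not edit; re-emit (HOME/census/search-7/emit_kernel.py).
-/

namespace Summit.Ventures.QEC.Census.BB72

/-- Level-2 chunks `(15, j)`, `8 ≤ j < 31`, side X of `BB72` (197777 end points): pass. -/
theorem kX2_15_8 : chunk2R (leafTest []) (posList 72 cert.HZ) 3 15 8 23 = true := by decide +kernel

/-- Level-2 chunks `(15, j)`, `31 ≤ j < 56`, side X of `BB72` (15275 end points): pass. -/
theorem kX2_15_31 : chunk2R (leafTest []) (posList 72 cert.HZ) 3 15 31 25 = true := by decide +kernel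

/-- Level-2 chunks `(16, j)`, `0 ≤ j < 9`, side X of `BB72` (189384 end points): pass. -/
theorem kX2_16_0 : chunk2R (leafTest []) (posList 72 cert.HZ) 3 16 0 9 = true := by decide +kernel

/-- Level-2 chunks `(16, j)`, `9 ≤ j < 55`, side X of `BB72` (179446 end points): pass. -/
theorem kX2_16_9 : chunk2R (leafTest []) (posList 72 cert.HZ) 3 16 9 46 = true := by decide +kernel

/-- Level-2 chunks `(17, j)`, `0 ≤ j < 10`, side X of `BB72` (192555 end points): pass. -/
theorem kX2_17_0 : chunk2R (leafTest []) (posList 72 cert.HZ) 3 17 0 10 = true := by decide +kernel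

/-- Level-2 chunks `(17, j)`, `10 ≤ j < 54`, side X of `BB72` (149985 end points): pass. -/
theorem kX2_17_10 : chunk2R (leafTest []) (posList 72 cert.HZ) 3 17 10 44 = true := by decide +kernel

/-- Level-2 chunks `(18, j)`, `0 ≤ j < 11`, side X of `BB72` (193369 end points): pass. -/
theorem kX2_18_0 : chunk2R (leafTest []) (posList 72 cert.HZ) 3 18 0 11 = true := by decide +kernel

/-- Level-2 chunks `(18, j)`, `11 ≤ j < 53`, side X of `BB72` (124313 end points): pass. -/
theorem kX2_18_11 : chunk2R (leafTest []) (posList 72 cert.HZ) 3 18 11 42 = true := by decide +kernel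

/-- Level-2 chunks `(19, j)`, `0 ≤ j < 12`, side X of `BB72` (192113 end points): pass. -/
theorem kX2_19_0 : chunk2R (leafTest []) (posList 72 cert.HZ) 3 19 0 12 = true := by decide +kernel

/-- Level-2 chunks `(19, j)`, `12 ≤ j < 52`, side X of `BB72` (102090 end points): pass. -/
theorem kX2_19_12 : chunk2R (leafTest []) (posList 72 cert.HZ) 3 19 12 40 = true := by decide +kernel

end Summit.Ventures.QEC.Census.BB72
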